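import Summits.QuantumFields.YangMills.Theorems.BalabanUVNodesPortS1ClassTwins
import Literature.MathematicalPhysics.QuantumFieldTheory.Balaban1983to89.Node00.BackgroundCurrentShape
import Summits.QuantumFields.YangMills.Theorems.BalabanUVNodesN09BackgroundRadiiTransfer

/-!
# NODE O port PT-A — (M8a): THE (1.14) CURRENT ROW OF `RegThm1RowsAtRecord` AT CLASS POINTS ⇐ THE TREE'S EXISTING LETTER `Node00.UkCurrentSmall` (GAPS G₈a-3,
# «U_k(V) of ₈a satisfies the current clause of [I] (1.2)») — dictionary `recordCurrent = currentOfRecord ∘ recordBgField` + orbit transfer; NO new letter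

Cell `ym-nodeO-ideate`, porter seat PT-A-1 (gen 12, «the [15] desk»; ★★★ director-ym №657 «unless a row is typable tonight» — this one is); `--kind proof --supports stmt-QuantumFields-27930
--as helper`; count-neutral.  [I] = [Balaban1987RG1]; [15] = [Balaban1985Variational].

LOCATED (memo, nodeO STATUS ≈20:58Z).  ✓`RegThm1RowsAtRecord` (p833569) displays two rows at every class point `B`: (1.12) local gauges and (1.14) `|J(U_{k+1}(W_B))(b)| < α₀`.
Print derives (1.14) for minimisers from [15] Thm 1 (8) (membership in 𝔘_k(B₃ε₁), whose (2) p.278 carries the current clause) — [I] p.260: «implied by the condition on V, with 2ε₀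
replaced by B₃⁻¹ε₀, see Theorem 1 [15]».  The tree NAMES exactly this supplier statement: lit `Node00.UkCurrentSmall F N K k ε ε₀` («`U_k(V)` of ₈a satisfies the current clause
`CurrentSmall … ε₀`», GAPS row G₈a-3, `Node00/BackgroundCurrentShape` §5; asserted nowhere).  This file reduces (M8a) to that EXISTING name — so (M8)'s open content is the (1.12)
row alone plus G₈a-3.

WHAT (ns `Summit.QuantumFields.YangMills.Theorems.BalabanUVNodesPortS1`; `K = K₀ + n` written `recordK₀ F Mc k + n` throughout, never abbreviated):
* §1 DICTIONARY: `slProj_two_eq_sl2Proj` (`π` of lit = `π` of the port: both `X ↦ X − ½·tr X·1`), `cfgGL_two_eq` (`cfgGL 2 U b = ιSU 2 (U b)`: the same unit of `M₂(ℂ)`),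
  ★ `recordCurrent_eq_currentOfRecord` — the port's current `J_{k+1}(W_B) = current sl2Proj η_{k+1} (recordBgUnits …)` IS lit's `currentOfRecord F 2 K (k+1) (recordBgField … B)`.
* §2 ★★ `currentSmall_recordBgField_of_ukCurrentSmall` — THE RATE-HONEST INSTANCE: at a class point (`InRegClass … ε₀ … B`, `0 < ε₀ ≤ 1∕(53581824 L⁶)`, `2ε₀ ≤ ε₁`, `ε₀ ≤ a₀`, TokE
  at `ε₁`), `UkCurrentSmall F 2 K (k+1) ε₀ αJ` (G₈a-3 AT THE CLASS RADIUS `ε₀`, any rate `αJ` — the supplier delivers `αJ = c_J ε₀`) ⟹ `CurrentSmall F 2 K (k+1) αJ (U_{k+1}(W_B))`: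
  `U_{k+1}(W_B)` and `Uk … ε₀ W_B` both minimise over `bgReg a₀` (argmin radii transfer BY NAME: ✓`N09BackgroundRadiiTransfer.isBackground_of_le_of_mem` ∕ `…_of_le_of_isBackground_mem`, ◆ C76), TokE's `UniqueUkOrbit … a₀ W_B` puts them in one orbit, the current clause is gauge invariant.
* §3 ★★ `currentRow_of_ukCurrentSmall` — the (1.14) ROW OF THE LETTER verbatim (`∀ X, ∀ b ∈ domBonds …, ‖recordCurrent … B b‖ < α₀`) from §2 + §1, given `αJ ≤ α₀`.

HONEST FRAMING.  A REDUCTION of one displayed row to an EXISTING unproved named letter (G₈a-3 = [15] Thm 1 (8) at the record) — NOT a discharge: `UkCurrentSmall` is inhabited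
nowhere; the (1.12) row of `RegThm1RowsAtRecord` is untouched (XL, [15] Thm 1 (9)); `RegThm1RowsAtRecord`, `RegClassNestsUc`, `stub_regClassNestsUc` stay OPEN; registry untouched
(⟨27930⟩ 2∕7); NODE O 0∕1 · COUNT 8∕28 · K 1∕4 UNMOVED; finite `𝕋⁴_{L^K}` at fixed ε — NOT continuum ∕ OS; **the Yang–Mills mass gap (Clay) is NOT proved by any of this.**
No `sorry`, no `def`, no `instance`; standard axioms.
-/

noncomputable section

open scoped BigOperators Matrix.Norms.L2Operator Topology

namespace Summit.QuantumFields.YangMills.Theorems.BalabanUVNodesPortS1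

open Summit.QuantumFields.YangMills.Theorems.K0RecordFormatNames
open Literature.MathematicalPhysics.QuantumFieldTheory.Balaban1983to89
open Literature.MathematicalPhysics.QuantumFieldTheory.Balaban1983to89.Node00
open Literature.MathematicalPhysics.QuantumFieldTheory.Balaban1983to89.T4Continuum (T4Family)

variable (F : T4Family)

/-! ## §1  Dictionary: the port's current is lit's `currentOfRecord` at `U_{k+1}(W_B)` -/

/-- `π` of lit (`B12Lemma4Models.slProj 2 : X ↦ X − (2⁻¹·tr X)·1`) IS the port's `sl2Proj` (`X ↦ X − 2⁻¹·(tr X·1)`). [cite: Balaban1987RG1, (1.8) p.261 (dictionary)] -/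
theorem slProj_two_eq_sl2Proj : B12Lemma4Models.slProj 2 = sl2Proj := by
  apply LinearMap.ext
  intro X
  rw [B12Lemma4Models.slProj_apply]
  simp only [sl2Proj, LinearMap.sub_apply, LinearMap.id_apply, LinearMap.smul_apply, LinearMap.comp_apply, LinearMap.toSpanSingleton_apply,
    Matrix.traceLinearMap_apply, smul_smul, Nat.cast_ofNat]

/-- `𝐔` of lit (`cfgGL 2 U = unitsField (toUField U)`) IS the port's `ιSU 2 ∘ U` — the same unit of `M₂(ℂ)` over the same matrix. [cite: Balaban1987RG1, (1.10) p.262 (dictionary)] -/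
theorem cfgGL_two_eq {K : ℕ} (U : GaugeField (F.P K) 0 (SU 2)) : cfgGL 2 U = fun b => ιSU 2 (U b) := by
  funext b
  exact Units.ext rfl

/-- ★ **THE PORT'S CURRENT IS LIT'S `currentOfRecord` AT `U_{k+1}(W_B)`**: `recordCurrent F θ k K B = currentOfRecord F 2 K (k+1) (recordBgField F θ k K B)` — both are the tree's
(1.8) `B12Eq18Current.current π η_{k+1} 𝐔` at the same `π`, `η`, `𝐔` (§1's two identities). [cite: Balaban1987RG1, (1.8) p.261, (1.2) p.260] -/
theorem recordCurrent_eq_currentOfRecord (θ : Stage13Params F 2) (k K : ℕ) (B : Fin (F.P K).d → Site (F.P K) (k + 1) → θ.Vβ) :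
    letI := θ.instVβ₁; letI := θ.instVβ₂
    recordCurrent F θ k K B = currentOfRecord F 2 K (k + 1) (recordBgField F θ k K B) := by
  letI := θ.instVβ₁; letI := θ.instVβ₂
  rw [recordCurrent, currentOfRecord, slProj_two_eq_sl2Proj, cfgGL_two_eq]
  rfl

/-! ## §2  ★★ At a class point: G₈a-3's letter AT THE CLASS RADIUS ⟹ the current clause for `U_{k+1}(W_B)` -/

variable (a₀ ε₂₉ : ℝ) (Mc k n : ℕ) {ε₀ ε₁ : ℝ}

/-- ★★ **THE CURRENT CLAUSE FOR `U_{k+1}(W_B)` ON THE CLASS FROM THE TREE'S LETTER `UkCurrentSmall` (G₈a-3) AT THE CLASS RADIUS `ε₀`** (the honest rate lever — print [I] p.263 L9–13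
«the minimal configurations U_j satisfying |∂U_j − 1| < ε₀ξ² with ε₀ sufficiently small satisfy the above conditions», p.260 «implied by the condition on V, with 2ε₀ replaced by B₃⁻¹ε₀»):
at a class point `B` (`InRegClass … ε₀ … B`, `0 < ε₀ ≤ 1∕(53581824L⁶)`, `2ε₀ ≤ ε₁`, `ε₀ ≤ a₀`) under the TokE shape at `ε₁` (as ✓`…ClassTwins` displays it), the letter
`UkCurrentSmall F 2 K (k+1) ε₀ αJ` («every `Uk … ε₀ V` with `UkExists … ε₀ V` has `|J| < αJ`»; the supplier's deliverable is `αJ = c_J·ε₀` for `ε₀ ≤ ε_J` — [B7] Prop. 2 + [15] Thm 1 (8))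
gives `CurrentSmall F 2 K (k+1) αJ (U_{k+1}(W_B))`.  PROOF (argmin bookkeeping, no estimate): `U_{k+1}(W_B)` minimises over `bgReg a₀` (✓`isBackground_recordBgField_of_inRegClass`) and lies in
`bgReg ε₀ ⊆ bgReg a₀` (the class), so it minimises over `bgReg ε₀` (✓`isBackground_of_le_of_mem`) — hence `UkExists … ε₀ W_B`, the letter applies to `Uk … ε₀ W_B`, which in turn minimises over `bgReg a₀`
(✓`isBackground_of_le_of_isBackground_mem`, equal minimal values); TokE's `UniqueUkOrbit … a₀ W_B` (at `PlaqSmall ε₁ W_B`, ✓`plaqSmall_unitField_of_inRegClass`) puts the two in ONE orbit, and the current clause is gauge invariant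
(✓`currentSmall_gaugeAct_iff`).  Reduction to an EXISTING unproved letter; nothing discharged.
[cite: Balaban1987RG1, (1.2) p.260, p.263 L5–13, (0.21) p.256; Balaban1985Variational, Thm 1 (8) p.279, (2) p.278; Balaban1985Averaging, Prop. 2 p.26] -/
theorem currentSmall_recordBgField_of_ukCurrentSmall (hε₀ : 0 < ε₀) (hc : ε₀ ≤ 1 / (53581824 * (F.L : ℝ) ^ 6)) (hε₁ : 2 * ε₀ ≤ ε₁) (hε₀a : ε₀ ≤ a₀)
    (hTokE : ∀ V : GaugeField (F.P (recordK₀ F Mc k + n)) (k + 1) (SU 2), PlaqSmall ε₁ V →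
      UkExists F 2 (recordK₀ F Mc k + n) (k + 1) a₀ V ∧ UniqueUkOrbit F 2 (recordK₀ F Mc k + n) (k + 1) a₀ V)
    {αJ : ℝ} (hJ : UkCurrentSmall F 2 (recordK₀ F Mc k + n) (k + 1) ε₀ αJ)
    {B : recordW F a₀ ε₂₉ k (recordK₀ F Mc k + n)} (hB : InRegClass F Mc k ε₀ a₀ ε₂₉ n B) :
    letI θ := thetaFill F a₀ ε₂₉
    CurrentSmall F 2 (recordK₀ F Mc k + n) (k + 1) αJ (recordBgField F θ k (recordK₀ F Mc k + n) B) := by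
  obtain ⟨h1, h2, -⟩ := classRadius_bounds F hε₀ hc
  have hW : PlaqSmall ε₁ (unitField F (thetaFill F a₀ ε₂₉) k (recordK₀ F Mc k + n) B) := fun p =>
    (plaqSmall_unitField_of_inRegClass F a₀ ε₂₉ Mc k n hε₀ h1 h2 hB p).trans_le hε₁
  obtain ⟨-, huniq⟩ := hTokE _ hW
  -- `U_{k+1}(W_B)` minimises over `bgReg a₀` and lies in `bgReg ε₀ ⊆ bgReg a₀`: it minimises over `bgReg ε₀` (N09's radii transfer, by name)
  have hbgA := isBackground_recordBgField_of_inRegClass F a₀ ε₂₉ Mc k n hB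
  have hbgE := BalabanUVNodes.N09BackgroundRadiiTransfer.isBackground_of_le_of_mem hε₀a hbgA hB.2
  have hex : UkExists F 2 (recordK₀ F Mc k + n) (k + 1) ε₀ (unitField F (thetaFill F a₀ ε₂₉) k (recordK₀ F Mc k + n) B) := ⟨_, hbgE⟩
  -- the letter at the class radius, for `Uk … ε₀ W_B`; that minimiser also minimises over `bgReg a₀` (equal minimal values)
  have hcs := hJ _ hex
  have hUkA := BalabanUVNodes.N09BackgroundRadiiTransfer.isBackground_of_le_of_isBackground_mem hε₀a hbgA hB.2 (isBackground_Uk hex)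
  -- one orbit (TokE's uniqueness at `a₀`), and the current clause is gauge invariant
  obtain ⟨u, -, hu⟩ := huniq _ _ hUkA hbgA
  rw [hu]
  exact (currentSmall_gaugeAct_iff u _).2 hcs

/-! ## §3  ★★ The (1.14) row of `RegThm1RowsAtRecord`, verbatim, from G₈a-3's letter at the class radius -/

/-- ★★ **(M8a) — THE (1.14) ROW OF ✓`RegThm1RowsAtRecord` AT A CLASS POINT ⇐ `UkCurrentSmall … ε₀ αJ` WITH `αJ ≤ α₀`**: `∀ X, ∀ b ∈ domBonds …, ‖J_{k+1}(W_B)(b)‖ < α₀` (the letter's second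
conjunct, verbatim) from §2 and the dictionary §1 (the bound holds on EVERY fine bond; the restriction to `domBonds X` is the letter's display).  With the supplier's rate `αJ = c_J ε₀`
the letter's `εn` is `min (…) (α₀ ∕ c_J)`. [cite: Balaban1987RG1, (1.14) p.262, (1.2) p.260, p.263 L9–13; Balaban1985Variational, Thm 1 (8) p.279] -/
theorem currentRow_of_ukCurrentSmall (hε₀ : 0 < ε₀) (hc : ε₀ ≤ 1 / (53581824 * (F.L : ℝ) ^ 6)) (hε₁ : 2 * ε₀ ≤ ε₁) (hε₀a : ε₀ ≤ a₀)
    (hTokE : ∀ V : GaugeField (F.P (recordK₀ F Mc k + n)) (k + 1) (SU 2), PlaqSmall ε₁ V →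
      UkExists F 2 (recordK₀ F Mc k + n) (k + 1) a₀ V ∧ UniqueUkOrbit F 2 (recordK₀ F Mc k + n) (k + 1) a₀ V)
    {αJ α₀ : ℝ} (hJ : UkCurrentSmall F 2 (recordK₀ F Mc k + n) (k + 1) ε₀ αJ) (hαJ : αJ ≤ α₀)
    {B : recordW F a₀ ε₂₉ k (recordK₀ F Mc k + n)} (hB : InRegClass F Mc k ε₀ a₀ ε₂₉ n B) :
    letI θ := thetaFill F a₀ ε₂₉
    ∀ (X : (recordDomSys F Mc k (recordK₀ F Mc k + n)).Dom), ∀ b ∈ domBonds F Mc k (recordK₀ F Mc k + n) X,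
      ‖recordCurrent F θ k (recordK₀ F Mc k + n) B b‖ < α₀ := by
  intro X b _
  have h := currentSmall_recordBgField_of_ukCurrentSmall F a₀ ε₂₉ Mc k n hε₀ hc hε₁ hε₀a hTokE hJ hB b
  rw [recordCurrent_eq_currentOfRecord]
  exact h.trans_le hαJ

end Summit.QuantumFields.YangMills.Theorems.BalabanUVNodesPortS1

end
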